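import Literature.IUT.HodgeTheaters.PiAvatarGlobalInvolution
import HarnessLib

/-!
# Deck transformations of a double covering in the Π-avatar orbit category, and the two automorphisms of
# `𝒟^{⊚±} = ℬ(X̲_K)⁰` over `𝒟^⊚ = ℬ(C̲_K)⁰` at the genuine initial Θ-data (proof-only)

S. Mochizuki, *Inter-universal Teichmüller theory I*, kurims manuscript (May 2020), Def 6.1 (v) p. 158 ("we have a
finite étale double covering `𝒟^{⊚±} → 𝒟^⊚ = ℬ(C̲_K)⁰`"; "`Aut_K(X̲_K) ⥲ Aut_±(𝒟^{⊚±})/Aut_csp(𝒟^{⊚±}) ⥲ 𝔽_l^{⋊±}` …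
the subgroup `Gal(X̲_K/X_K) ⊆ Aut_K(X̲_K)`") and Def 6.1 (iii) p. 157 ("natural surjection `Aut(†𝒟_v) ↠ {±1}`")
([IUTchI] Def 6.1 (v) p.158) [claim: Mochizuki2012, status: disputed] (D-0012 claim key, series status DISPUTED —
GROUP-THEORETIC PLUMBING + an instance-level consequence over abc-iut-L5-t2's REAL `InitialThetaData`; nothing of the
series is asserted, no side is taken on [IUTchIII] Cor. 3.12).

Over abc-iut-L5-t4's orbit category (`PiAvatarOrbitCategory*`, p419432/p420087; embedded design D1):

* `OrbitCat.exists_proj` — the covering morphism `A/H → A/K` for `H ≤ K` (`xH ↦ xK`) exists (it is `homOfElem 1`);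
* `OrbitCat.autOfNormalizer_comp_proj_iff` — the automorphism `xH ↦ xnH` lies OVER `A/K` (commutes with the
  covering) iff `n ∈ K`: the deck transformations of `ℬ(H)⁰ → ℬ(K)⁰` are `N_K(H)/H`;
* `OrbitCat.deck_dichotomy_of_relIndex_eq_two` — for `[K : H] = 2` every automorphism of `ℬ(H)⁰` over `ℬ(K)⁰` is the
  identity or THE involution (the one of `exists_involution_of_relIndex_eq_two`), and these two differ;
* instance: `InitialThetaData.deck_dichotomy_globalDoubleCover` — at the genuine initial Θ-data, every automorphism of
  `𝒟^{⊚±} = ℬ(X̲_K)⁰` (object `OrbitCat.of D.PiXund` of `OrbitCat Π_{C_F}`) over `𝒟^⊚ = ℬ(C̲_K)⁰` (`OrbitCat.of D.PiCund`)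
  is the identity or the `±`-involution of `PiAvatarGlobalInvolution` (Def 6.1 (v): the covering is a DOUBLE covering,
  deck group `{±1} ⊆ 𝔽_l^{⋊±}`).

Proof-only; typed ≠ proved elsewhere.
-/

namespace Literature.IUT.HodgeTheaters

open CategoryTheory

universe u v w

namespace OrbitCat

variable {A : Type u} [Group A]

/-- The covering morphism `ℬ(H)⁰ → ℬ(K)⁰`, i.e. `A/H → A/K`, `xH ↦ xK`, for `H ≤ K` ([IUTchI] Def 6.1 (v) p.158: the
double covering `𝒟^{⊚±} → 𝒟^⊚`; Def 6.1 (ii): `†𝒟_v → †𝒟_v^±`). A theorem-level abbreviation of `homOfElem 1`.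
([IUTchI] Def 6.1 (v) p.158) [claim: Mochizuki2012, status: disputed] -/
theorem exists_proj {H K : Subgroup A} (hHK : H ≤ K) :
    ∃ π : (of H : OrbitCat A) ⟶ of K, ∀ x : A, fn π (QuotientGroup.mk x) = QuotientGroup.mk x := by
  refine ⟨homOfElem 1 fun x hx => ?_, fun x => ?_⟩
  · simpa using hHK hx
  · rw [fn_homOfElem, mul_one]

/-- **Deck transformations.** For `n ∈ N_A(H)` and any morphism `π : A/H → A/K` with `π(xH) = xK` (the covering,
`H ≤ K`): the automorphism `xH ↦ xnH` commutes with `π` iff `n ∈ K` — the deck transformations of `ℬ(H)⁰ → ℬ(K)⁰` are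
`N_K(H)/H` ([IUTchI] Def 6.1 (v) p.158: `Gal(X̲_K/C̲_K)`, `Gal(X̲_K/X_K) ⊆ Aut_K(X̲_K)`).
([IUTchI] Def 6.1 (v) p.158) [claim: Mochizuki2012, status: disputed] -/
theorem autOfNormalizer_comp_proj_iff {H K : Subgroup A} {n : A} (hn : n ∈ Subgroup.normalizer (H : Set A))
    (π : (of H : OrbitCat A) ⟶ of K) (hπ : ∀ x : A, fn π (QuotientGroup.mk x) = QuotientGroup.mk x) :
    (autOfNormalizer n hn).hom ≫ π = π ↔ n ∈ K := by
  constructor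
  · intro h
    have h1 := congrArg (fun φ => fn φ (QuotientGroup.mk (1 : A))) h
    simp only [fn_comp, Function.comp_apply, fn_autOfNormalizer_hom, one_mul, hπ] at h1
    -- `nK = 1K`
    have h2 : n⁻¹ * 1 ∈ K := QuotientGroup.eq.mp h1
    rw [mul_one] at h2
    simpa using K.inv_mem h2
  · intro hnK
    apply hom_ext_fn
    funext q
    induction q using Quotient.inductionOn' with
    | h x =>
      change fn π (fn (autOfNormalizer n hn).hom (QuotientGroup.mk x)) = fn π (QuotientGroup.mk x)
      rw [fn_autOfNormalizer_hom, hπ, hπ, QuotientGroup.eq]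
      simpa [mul_inv_rev, mul_assoc] using K.inv_mem hnK

/-- **Dichotomy of deck transformations of a double covering.** If `[K : H] = 2` then every automorphism of
`ℬ(H)⁰` over `ℬ(K)⁰` is the identity or the involution induced by any fixed `a ∈ K \ H`, and these two are distinct
([IUTchI] Def 6.1 (v): deck group of `𝒟^{⊚±} → 𝒟^⊚` = `{±1}`; Def 6.1 (iii): `Aut ↠ {±1}`).
([IUTchI] Def 6.1 (v) p.158) [claim: Mochizuki2012, status: disputed] -/
theorem deck_dichotomy_of_relIndex_eq_two {H K : Subgroup A} (hHK : H ≤ K) (h2 : H.relIndex K = 2)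
    {a : A} (haK : a ∈ K) (haH : a ∉ H)
    (π : (of H : OrbitCat A) ⟶ of K) (hπ : ∀ x : A, fn π (QuotientGroup.mk x) = QuotientGroup.mk x)
    (e : (of H : OrbitCat A) ≅ of H) (he : e.hom ≫ π = π) :
    (e = Iso.refl _ ∨ e = autOfNormalizer a (le_normalizer_of_relIndex_eq_two hHK h2 haK)) ∧
      autOfNormalizer a (le_normalizer_of_relIndex_eq_two hHK h2 haK) ≠ Iso.refl (of H) := by
  have hKN : K ≤ Subgroup.normalizer (H : Set A) := le_normalizer_of_relIndex_eq_two hHK h2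
  refine ⟨?_, fun h => haH ((autOfNormalizer_eq_refl_iff _).1 h)⟩
  obtain ⟨n, hn, rfl⟩ := exists_eq_autOfNormalizer e
  have hnK : n ∈ K := (autOfNormalizer_comp_proj_iff hn π hπ).1 he
  by_cases hnH : n ∈ H
  · exact Or.inl ((autOfNormalizer_eq_refl_iff hn).2 hnH)
  · right
    rw [autOfNormalizer_eq_iff]
    -- index two: `n, a ∈ K \ H ⇒ n⁻¹ a ∈ H`
    have key := (Subgroup.mul_mem_iff_of_index_two h2 (a := ⟨n⁻¹, K.inv_mem hnK⟩) (b := ⟨a, haK⟩)).2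
    have hmem : (⟨n⁻¹, K.inv_mem hnK⟩ * ⟨a, haK⟩ : K) ∈ H.subgroupOf K := by
      apply key
      simp only [Subgroup.mem_subgroupOf]
      exact ⟨fun h => absurd (by simpa using H.inv_mem h) hnH, fun h => absurd h haH⟩
    exact Subgroup.mem_subgroupOf.mp hmem

end OrbitCat

/-! ### Instance: the two automorphisms of `𝒟^{⊚±}` over `𝒟^⊚` at the genuine initial Θ-data -/

section Global

variable {F : Type u} {K : Type v} {Fbar : Type w} [Field F] [NumberField F] [Field K]
  [NumberField K] [Algebra F K] [Field Fbar] [Algebra F Fbar] [Algebra K Fbar]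
  {E : WeierstrassCurve F} [E.IsElliptic] {l : ℕ} {P : BadPlacePredicates K}
  (D : InitialThetaData F K Fbar E l P)

namespace InitialThetaData

/-- **`𝒟^{⊚±} → 𝒟^⊚` is a DOUBLE covering at the genuine data**: for the covering morphism
`ℬ(X̲_K)⁰ → ℬ(C̲_K)⁰` in the orbit category of `Π_{C_F}` (objects `OrbitCat.of D.PiXund`, `OrbitCat.of D.PiCund`) every
automorphism of `𝒟^{⊚±}` over `𝒟^⊚` is the identity or the `±`-involution, which is not the identity
([IUTchI] Def 6.1 (v) p.158; index `[Π_{C̲_K} : Π_{X̲_K}] = 2` = abc-iut-L5-t2's `ThetaGeometry.PiXbar_relIndex_PiCbar`).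
([IUTchI] Def 6.1 (v) p.158) [claim: Mochizuki2012, status: disputed] -/
theorem deck_dichotomy_globalDoubleCover {a : D.PiC} (haK : a ∈ D.PiCund) (haH : a ∉ D.PiXund)
    (π : (OrbitCat.of D.PiXund : OrbitCat D.PiC) ⟶ OrbitCat.of D.PiCund)
    (hπ : ∀ x : D.PiC, OrbitCat.fn π (QuotientGroup.mk x) = QuotientGroup.mk x)
    (e : (OrbitCat.of D.PiXund : OrbitCat D.PiC) ≅ OrbitCat.of D.PiXund) (he : e.hom ≫ π = π) :
    (e = Iso.refl _ ∨
        e = OrbitCat.autOfNormalizer a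
          (OrbitCat.le_normalizer_of_relIndex_eq_two D.PiXund_le_PiCund D.piXund_relIndex_piCund haK)) ∧
      OrbitCat.autOfNormalizer a
          (OrbitCat.le_normalizer_of_relIndex_eq_two D.PiXund_le_PiCund D.piXund_relIndex_piCund haK) ≠
        Iso.refl _ :=
  OrbitCat.deck_dichotomy_of_relIndex_eq_two D.PiXund_le_PiCund D.piXund_relIndex_piCund haK haH π hπ e he

/-- The covering morphism `𝒟^{⊚±} → 𝒟^⊚` exists in the orbit category of `Π_{C_F}` and an element `a ∈ Π_{C̲_K} \ Π_{X̲_K}`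
exists (so the dichotomy above is not vacuous). ([IUTchI] Def 6.1 (v) p.158) [claim: Mochizuki2012, status: disputed] -/
theorem exists_globalDoubleCover_data :
    (∃ π : (OrbitCat.of D.PiXund : OrbitCat D.PiC) ⟶ OrbitCat.of D.PiCund,
        ∀ x : D.PiC, OrbitCat.fn π (QuotientGroup.mk x) = QuotientGroup.mk x) ∧
      ∃ a : D.PiC, a ∈ D.PiCund ∧ a ∉ D.PiXund := by
  refine ⟨OrbitCat.exists_proj D.PiXund_le_PiCund, ?_⟩
  obtain ⟨a, -, haK, haH, -⟩ := D.exists_globalInvolution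
  exact ⟨a, haK, haH⟩

end InitialThetaData

end Global

end Literature.IUT.HodgeTheaters
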